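/-
Copyright: lit-balaban cell, Phase-2 proof seat p11 (gen 6).  Statement-level skeleton of a published paper; no proof claims beyond
what the kernel checks below.
-/
import Literature.MathematicalPhysics.QuantumFieldTheory.BalabanImbrieJaffe1984to88.BIJ85Ineq732SecondForm
import Literature.MathematicalPhysics.QuantumFieldTheory.BalabanImbrieJaffe1984to88.BIJ85Claim73Closed
import Literature.MathematicalPhysics.QuantumFieldTheory.BalabanImbrieJaffe1984to88.BIJ85Claim73ActualOne
import Literature.MathematicalPhysics.QuantumFieldTheory.BalabanImbrieJaffe1984to88.BIJ88Eq541Base0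

/-!
# `BalabanImbrieJaffe1984to88.BIJ85Claim73SecondForm` — T. Bałaban, J. Imbrie, A. Jaffe, *Renormalization of the Higgs model:
minimizers, propagators and the stability of mean field theory*, Commun. Math. Phys. **97** (1985) 299–329
[BalabanImbrieJaffe1985]: Sect. 7.3 p. 326 — **THE SECOND PRINTED FORM OF (7.3.2) (`v_b` in the covariant derivative of `φ`) FOR THE
ACTUAL BACKGROUND (4.5.4) `u_k = Q^{s*}_kv·exp[−ie_kη(𝒟_k∂^*Q^{e*}_kf^{(k)})]` COMPUTED FROM `v` WITH THE OPERATORS OF RECORD**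
(p33 g7's `BIJ85Eq454PlaqResidual.actualBgU1`; `T_k = 𝒟_k∂^*Q^{e*}_k` = p31's `BIJ88Eq541Base0.TkF`).  By (4.5.3) the `Q^{s*}_kv`-transport
along a unit bond `b` is `v_b` exactly, so the gauge-INVARIANT defect between the two printed forms is
**`v_b^{−1}u_k(b) = exp(−ie_kη·Σ_{b′⊂b}(T_kf^{(k)})_{b′})`** — the LINE SUM of the (4.5.4) phase over the `L^k` `η`-bonds of `b`
(`lineIter_actualBgU1`).  Hence r15's typed claim `ScalarStabData.Claim73 𝓅` HOLDS FOR THE SECOND-FORM DATUM of the actual family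
(`covDiffSq ψ b = |v_bψ(b₊) − ψ(b₋)|²`, everything else as p33's `resStabData`: printed `plaqDev`, printed `a_k`, physical normalization,
THE inverse (4.6.2) at `u_k`) over the index `SecIdx d K_R K_T` = p33's `ResIdx d K_R` (located residual-curvature constant `K_R`:
`|f_k| ≤ K_R·max|f|`, Sect. 7.2; proved at `k = 1` by p33, k-uniform discharge in flight at p30 g9) PLUS the located LINE-SUM constant `K_T`:
`η·|Σ_{b′⊂b}(T_kg)_{b′}| ≤ K_T·max|g|` — constants `γ = ½min(a/(9(d+1)), 1/12)`, `α = ½`,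
`M = ((4/3)d⁴((π/2)K_R)² + min(a/(9(d+1)),1/12)·d·((π/2)K_T)²)(1+4𝓅₊)^{2𝓅₊}` (`claim73_second`); the same over p33's closed-field index
(`claim73_second_closed`); and **AT `k = 1` WITH NO LOCATED HYPOTHESIS** (`lineSumBound_one`: `K_T(1) = 4dL·M_Cd(2(1+d/δ_C))^d` from p09's
hypothesis-free (7.2.3) for `C^{(0)} = 𝒟₁`; `claim73_second_one`).  File B of the gen-6 member of SKELETON row **C1.Eq7.3.1-7.3.2**
(seat p11 gen 6; file A `BIJ85Ineq732SecondForm`).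

WHY A SECOND LOCATED CONSTANT (reading note, not kernelled beyond `k = 1`).  Testing the second form on two-site fields `ψ = αδ_x + βδ_{x+e_μ}`
shows that it forces `arg v_b ≈ arg u_k(b)` up to `O(√(M e_k^{2−α}/γ))`, i.e. `|e_kη·Σ_{b′⊂b}(T_kf^{(k)})_{b′}| ≲ e_k^{1−α/2}`: the line sums
of the smoothing potential along unit bonds must be `O(𝓅(e_k))`-bounded although the potential itself is of size `∼ L^k` next to the flux
tubes of `Q^{e*}_kf^{(k)}` (p09's `BIJ85Eq454PhaseLowerBound.exists_large_bond`).  The paper's mechanism (p. 326): *"we can substitute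
𝒟_k∂^* = G_{k,Ax}∂^* + ∂D"* — along a unit bond the axial part contributes only its corridor bond (axial gauge kills the tree bonds) and `∂D`
contributes `D(b₊) − D(b₋)` with `D` BOUNDED ((7.2.4): *"The gauge transformation λ in (5.1.1) is bounded"*): the angle function of a thin
flux tube is bounded while its gradient is not.  That is row C1.Eq7.2.4 / Sect. 7.2 territory and is NOT proved here.

statement-level skeleton of published theorems with citation tags; proofs where landed; nothing here is a claim about the Yang–Mills mass gap

PDF held: `paper:balaban1985-cmp97-bij-higgs-minimizers` (journal page = PDF page + 298).  Pages read this session (`lit read`, OCR text):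
p. 303–304 [PDF 5–6], p. 311–317 [PDF 13–19] ((4.4.4), (4.5.3)–(4.5.4), (5.1.1)–(5.1.4), (5.2.9)–(5.3.1)), p. 326 [PDF 28].

CITATION HEADER (lean-in-tree rule).  Phase-2 file of the lit-balaban TYPED SKELETON (HOME `run/shared/lean/pub/lit-balaban/`), seat
p11 gen 6 (unit `lit-balaban-p11-g6`; TAKING line HOME/STATUS.md 2026-08-21T20:03:16Z; owner r15, referee ref-5).  Objects BY NAME,
nothing re-declared: file A's `lineSumU`/`lineSumIter`/`lineIter_phase`/`ineq732_second_general_phys'`, p33's `actualBg`/`actualBgU1`/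
`smoothX`/`ResIdx`/`resG`/`resStabData`/`theta_of_hyp731_res`/`abs_plaqField_le_of_dev`/`ClosedIdx`/`closedG`/`theta_of_hyp731_closed`/
`OneIdx`/`K1`/`abs_QesOp_le`/`abs_adjoint_curlOp_le`/`DkE_one`/`rowSum_CE_zero_le`, p31's `TkF`/`qsstarG`/`qsstarGIter`/`qsstarGIter0`,
p30's `qsU1Iter`/`expField`, p34's `fieldEquiv`/`circleEquivU1`, p09's `ineq723_CE`, gen 5's `ineq732_general_phys`/`sq_hyp731_le`,
r15's `ScalarStabData`/`Claim73`.  Definitions with bodies (no `def … : Prop`, no named fact; D-0026): `lvl` (transport of a configuration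
along an equality of levels), `vK` (the unit-lattice field `v` on the `U1` carrier at the level `0 + k` of the scalar-field files), the
indices `SecIdx`/`SecClosedIdx` (located properties stated in place as fields), the data `secStabData`/`secClosedStabData`, `KT1`.

THE PRINTED TEXT, verbatim (p. 326 [PDF 28]): *"let us assume that for the unit lattice field v, |v(∂p) − 1| ≤ e_k𝓅(e_k), (7.3.1) where
𝓅(e_k) = (1 + ln e_k^{−1})^𝓅. Then the stability estimate can be stated in two forms. For constants γ > 0, α > 0, M < ∞, ⟨φ, Δ_k(u_k)φ⟩ ≥
γ Σ_{b∈T₁^{(k)}} |u_k(b)φ(b₊) − φ(b₋)|² − Me_k^{2−α} Σ_{x∈T₁^{(k)}} |φ(x)|². (7.3.2) The second form of the inequality substitutes v_b for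
u_k(b) in the covariant derivative of φ. These inequalities can be proved by an extension of the proofs of [7]. … we can substitute
𝒟_k∂^* = G_{k,Ax}∂^* + ∂D in the formula for u_k"*; p. 312 [PDF 14] (4.5.3) and p. 313 [PDF 15] (4.5.4) as in file A.

WHAT IS PROVED HERE (0 `sorry`, standard axioms).
* §1 the base-0 bridge: `qsstarGIter0_eq_qsstarGIter` (p31's two k-fold pull-backs agree along `0 + k = k`), `fieldEquiv_qsstarGIter0`,
  `fieldEquiv_qsU1Iter` (`Q^{s*}_kv` on the `U1` carrier IS `qsstarGIter k (vK k v)`), `lineIter_vK` (**the `Q^{s*}_kv`-transport along the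
  unit bond `b` is `v_b`**, (4.5.3)), `actualBgU1_eq`, **`lineIter_actualBgU1`** (`u_k(b) = v_b·exp(−ie_kη·lineSumIter(T_kf^{(k)})(b))`),
  **`norm_toC_lineIter_actualBgU1_sub_le`** (`|u_k(b) − v_b| ≤ |e_k|η·|Σ_{b′⊂b}(T_kf^{(k)})_{b′}|`).
* §2 `abs_plaqField_le_of_hyp` ((7.3.1) ⇒ `|f^{(k)}| ≤ (π/2)𝓅`), **`ineq732_second_actual`** (the second printed form for the actual `u_k`
  from the two sup-norm bounds, with the printed error `Me_k^{2−½}`), `SecIdx`, `secStabData`, **`ineq732_secStabData`**, **`claim73_second`**.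
* §3 the closed-field index (p33's `ClosedIdx` + `K_T` on closed `g`): `SecClosedIdx`, `secClosedStabData`, **`claim73_second_closed`**.
* §4 `k = 1` hypothesis-free: `abs_TkF_one_le` (`|(T₁g)_b| ≤ 4dL·M_Cd(2(1+d/δ_C))^d·max|g|` from `𝒟₁ = C^{(0)}` and (7.2.3)),
  **`lineSumBound_one`**, `KT1`, `secIdxOfOne`, **`claim73_second_one`**, `hyp731_second_one_iff`.
* §5 `exists_lineSumBound`: on each torus and scale the line-sum property holds with SOME constant (finite dimension) — the located content
  of `K_T` is UNIFORMITY in `k`, the volume and `g`.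
HONEST SCOPE.  (i) `K_R` and `K_T` uniform in `k` are located hypotheses (index fields); both discharged here/at p33 only at `k = 1`; for
general `k` they are Sect. 7.2 regularity (rows C1.Eq7.2.1-7.2.2 / C1.Eq7.2.4), not done here.  (ii) `0 < e_k ≤ 1`; base level `0`; the
scalar-field carriers are indexed by `0 + k` (`vK` transports `v` there).  (iii) Constants not optimized.
-/

open scoped RealInnerProductSpace BigOperators
open Finset Complex

namespace Literature.MathematicalPhysics.QuantumFieldTheory.BalabanImbrieJaffe1984to88.BIJ85Claim73SecondForm

open Literature.MathematicalPhysics.QuantumFieldTheory.Balaban1983to89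
open BIJ88Sect3Statements (U1 toC toC_one toC_mul norm_toC)
open BIJ88Sect3Rescaling (toC_injective_U1 fieldEquiv fieldEquiv_apply circleEquivU1)
open BIJ85Sect1Model (U1Field plaq)
open BIJ85SmallFieldSplit64 (plaqField expField)
open BIJ85BlockAveragesTorus BIJ85BlockAveragesTorusK BIJ85ScalarPropagatorTorus BIJ85ScalarPropagatorTorusK
open BIJ85ScalarForm464 BIJ85BlockAveragingIneq BIJ85Ineq732Flat BIJ85Ineq732General BIJ85Ineq732SecondForm
open BIJ85AbelianStokes (plaqC)
open BIJ85HolonomyDeviation (lineIter_mul)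
open BIJ85Ineq732PullBack (lineIter_qsstarGIter)
open BIJ85Ineq732Background (phase)
open BIJ85Eq453GaugeField (qsstarG qsstarG_apply qsstarGIter qsstarGIter_succ qsstarGIter0 qsstarGIter0_succ)
open BIJ85Eq622Torus (qsU1Iter)
open LatticeFieldCalculus (supDist)
open BIJ85AxialPropagator411 (BondSpace PlaqSpace curlOp)
open BIJ85Prop521Torus (toEj)
open BIJ85Prop522Torus (CE DkE)
open BIJ85Sigma421Torus (toU QesOp UnitPlaqSpace)
open BIJ85Sigma422Eta (eta_pos eta_inv)
open BIJ85Eq454PlaqResidual BIJ85Claim73Residual BIJ85Claim73Closed BIJ85Claim73ActualOne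
open BIJ85Ineq723TorusCE (ineq723_CE)
open BIJ88Decay216Native (cE_eq_smul_cE_one)
open BIJ88Eq541Base0 (TkF TkF_apply)

noncomputable section

variable {P : Params}

/-! ## §1 The base-0 bridge and the transports of the actual background along unit bonds -/

/-- transport of a configuration along an equality of levels (`Site P (0 + k)` and `Site P k` are equal, not definitionally).
[cite: BalabanImbrieJaffe1985, (2.1) p.302] -/
def lvl {G : Type*} {n n' : ℕ} (h : n = n') (V : GaugeField P n G) : GaugeField P n' G := h ▸ V

/-- kernel: transport commutes with the one-step pull-back (4.5.3). [cite: BalabanImbrieJaffe1985, (4.5.3) p.312] -/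
theorem lvl_qsstarG {G : Type*} [One G] {n n' : ℕ} (h : n = n') (h1 : n + 1 = n' + 1) (V : GaugeField P (n + 1) G) :
    lvl h (qsstarG V) = qsstarG (lvl h1 V) := by
  subst h
  rfl

/-- kernel: **p31's two k-fold pull-backs (4.5.3) agree** — `qsstarGIter0 k` (source level `k`) is `qsstarGIter k` (source level `0 + k`)
after transport, any gauge group. [cite: BalabanImbrieJaffe1985, (4.5.3) p.312] -/
theorem qsstarGIter0_eq_qsstarGIter {G : Type*} [One G] :
    ∀ (k : ℕ) (V : GaugeField P k G), qsstarGIter0 k V = qsstarGIter (i := 0) k (lvl (Nat.zero_add k).symm V)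
  | 0, _ => rfl
  | k + 1, V => by
    rw [qsstarGIter0_succ, qsstarGIter0_eq_qsstarGIter k (qsstarG V),
      lvl_qsstarG (Nat.zero_add k).symm (Nat.zero_add (k + 1)).symm V]
    rfl

/-- kernel: the carrier dictionary `Circle → U1` commutes with the one-step pull-back (it preserves `1`). [cite: BalabanImbrieJaffe1985, (4.5.3) p.312] -/
theorem fieldEquiv_qsstarG {n : ℕ} (V : U1Field P (n + 1)) : fieldEquiv (qsstarG V) = qsstarG (fieldEquiv V) := by
  funext b
  rw [fieldEquiv_apply, qsstarG_apply, qsstarG_apply]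
  split_ifs
  · exact map_one circleEquivU1
  · rfl

/-- kernel: … and with the k-fold pull-back. [cite: BalabanImbrieJaffe1985, (4.5.3) p.312] -/
theorem fieldEquiv_qsstarGIter0 : ∀ (k : ℕ) (v : U1Field P k), fieldEquiv (qsstarGIter0 k v) = qsstarGIter0 k (fieldEquiv v)
  | 0, _ => rfl
  | k + 1, v => by rw [qsstarGIter0_succ, qsstarGIter0_succ, fieldEquiv_qsstarGIter0 k, fieldEquiv_qsstarG]

/-- **the unit-lattice field `v` on `T^{(k)}` read on the `U1` carrier at the level `0 + k`** of the Sect. 4.6 / 7.3 scalar-field files (the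
bonds of the scalar datum are `PBond P (0 + k)`): `vK k v b = v_b`. [cite: BalabanImbrieJaffe1985, (7.3.2) p.326] -/
def vK (k : ℕ) (v : U1Field P k) : GaugeField P (0 + k) U1 := lvl (Nat.zero_add k).symm (fieldEquiv v)

/-- kernel: `|v_b| = 1`. [cite: BalabanImbrieJaffe1985, (4.5.1) p.312] -/
theorem norm_toC_vK (k : ℕ) (v : U1Field P k) (c : PBond P (0 + k)) : ‖toC (vK k v c)‖ = 1 := norm_toC _

/-- kernel: p30's `Q^{s*}_kv` (group-valued (4.5.3) on `Circle`) on the `U1` carrier is `qsstarGIter k (vK k v)`.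
[cite: BalabanImbrieJaffe1985, (4.5.3) p.312] -/
theorem fieldEquiv_qsU1Iter (k : ℕ) (v : U1Field P k) : fieldEquiv (qsU1Iter k v) = qsstarGIter k (vK k v) := by
  rw [qsU1Iter, fieldEquiv_qsstarGIter0, qsstarGIter0_eq_qsstarGIter]
  rfl

/-- **(4.5.3) ⇒ the transport of `Q^{s*}_kv` along the unit bond `b` is `v_b`** (`L^k − 1` interior bonds carrying `1`, one corridor bond
carrying `v_b`; p33's `lineIter_qsstarGIter`; standing range). [cite: BalabanImbrieJaffe1985, (4.5.3) p.312] -/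
theorem lineIter_vK {k : ℕ} (hk : k ≤ P.m + P.K) (v : U1Field P k) : lineIter (fieldEquiv (qsU1Iter k v)) k = vK k v := by
  rw [fieldEquiv_qsU1Iter]
  exact lineIter_qsstarGIter k (by omega) (vK k v)

/-- kernel: the carrier dictionary is multiplicative. [cite: BalabanImbrieJaffe1985, (6.2) p.318] -/
theorem fieldEquiv_mul {n : ℕ} (u w : U1Field P n) : fieldEquiv (u * w) = fun b => fieldEquiv u b * fieldEquiv w b := by
  funext b
  rw [fieldEquiv_apply, Pi.mul_apply, map_mul]
  rfl

/-- kernel: `exp(iεA)` on the `U1` carrier is p33's phase field. [cite: BalabanImbrieJaffe1985, (4.5.1) p.312] -/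
theorem fieldEquiv_expField {n : ℕ} (ε : ℝ) (A : PBond P n → ℝ) : fieldEquiv (expField ε A) = phase (fun b => ε * A b) := rfl

/-- kernel: p33's smoothing field `X = 𝒟_k∂^*Q^{e*}_kf^{(k)}` of (4.5.4) IS p31's `T_kf^{(k)}` (`T_k = 𝒟_k∂^*Q^{e*}_k`, weight `η^d`, lattice
factor `η⁻¹`) read componentwise. [cite: BalabanImbrieJaffe1985, (4.5.4) p.313] -/
theorem smoothX_eq_TkF (hd : 2 ≤ P.d) (k : ℕ) (e : ℝ) (v : U1Field P k) (b : PBond P 0) :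
    smoothX hd k e v b = TkF P hd ((P.eta k) ^ P.d) (P.eta k) k (plaqField e v) b := rfl

/-- kernel: **(4.5.4) on the `U1` carrier**: `u_k = qsstarGIter k (vK k v) · e^{iθ}` with the phase `θ_b = −e_kη(T_kf^{(k)})_b`.
[cite: BalabanImbrieJaffe1985, (4.5.4) p.313] -/
theorem actualBgU1_eq (hd : 2 ≤ P.d) (k : ℕ) (e : ℝ) (v : U1Field P k) :
    actualBgU1 hd k e v = fun b => qsstarGIter k (vK k v) b *
      phase (fun b => (e * P.eta k) * -TkF P hd ((P.eta k) ^ P.d) (P.eta k) k (plaqField e v) b) b := by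
  rw [actualBgU1, actualBg, fieldEquiv_mul, fieldEquiv_qsU1Iter, fieldEquiv_expField]
  rfl

/-- **THE TRANSPORTS OF THE ACTUAL BACKGROUND (4.5.4) ALONG UNIT BONDS**: `u_k(b) = v_b·exp(i·θ(b))` with `θ(b)` the LINE SUM of the phase
`−e_kη(T_kf^{(k)})` over the `L^k` `η`-bonds of `b` (standing range). [cite: BalabanImbrieJaffe1985, (4.5.4) p.313] -/
theorem lineIter_actualBgU1 (hd : 2 ≤ P.d) {k : ℕ} (hk : k ≤ P.m + P.K) (e : ℝ) (v : U1Field P k) :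
    lineIter (actualBgU1 hd k e v) k = fun c => vK k v c *
      phase (lineSumIter (fun b => (e * P.eta k) * -TkF P hd ((P.eta k) ^ P.d) (P.eta k) k (plaqField e v) b) k) c := by
  rw [actualBgU1_eq, lineIter_mul_phase, lineIter_qsstarGIter k (by omega) (vK k v)]

/-- **`|u_k(b) − v_b| ≤ |e_k|η·|Σ_{b′⊂b}(T_kf^{(k)})_{b′}|`** for the actual background and every unit bond `b` (`|e^{it} − 1| ≤ |t|`, linearity
of the line sums; standing range). [cite: BalabanImbrieJaffe1985, (7.3.2) p.326] -/
theorem norm_toC_lineIter_actualBgU1_sub_le (hd : 2 ≤ P.d) {k : ℕ} (hk : k ≤ P.m + P.K) (e : ℝ) (v : U1Field P k)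
    (c : PBond P (0 + k)) :
    ‖toC (lineIter (actualBgU1 hd k e v) k c) - toC (vK k v c)‖ ≤
      |e| * P.eta k * |lineSumIter (TkF P hd ((P.eta k) ^ P.d) (P.eta k) k (plaqField e v)) k c| := by
  rw [actualBgU1_eq]
  refine (norm_toC_lineIter_mul_phase_sub_le _ _ k (lineIter_qsstarGIter k (by omega) (vK k v)) c).trans (le_of_eq ?_)
  have e1 : (fun b => (e * P.eta k) * -TkF P hd ((P.eta k) ^ P.d) (P.eta k) k (plaqField e v) b)
      = fun b => -(e * P.eta k) * TkF P hd ((P.eta k) ^ P.d) (P.eta k) k (plaqField e v) b := by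
    funext b; ring
  rw [e1, lineSumIter_smul, abs_mul, abs_neg, abs_mul, abs_of_pos (eta_pos P k)]

/-! ## §2 The second printed form for the actual background from the two located sup-norm bounds; the index and the datum -/

/-- kernel: **(7.3.1) ⇒ `|f^{(k)}(q)| ≤ (π/2)𝓅(e)`** for `f^{(k)} = (ie)^{−1} ln v(∂·)` (branch (2.11); p33's `abs_plaqField_le_of_dev`; `e > 0`).
[cite: BalabanImbrieJaffe1985, (7.3.1) p.326] -/
theorem abs_plaqField_le_of_hyp {j : ℕ} {e : ℝ} (he : 0 < e) (v : U1Field P j) {calP : ℝ}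
    (h : ∀ p, ‖((plaq v p : Circle) : ℂ) - 1‖ ≤ e * calP) (q : Balaban1983to89.Plaq P j) :
    |plaqField e v q| ≤ Real.pi / 2 * calP :=
  calc |plaqField e v q| ≤ Real.pi / 2 * ‖((plaq v q : Circle) : ℂ) - 1‖ / e := abs_plaqField_le_of_dev he v q
    _ ≤ Real.pi / 2 * (e * calP) / e := by gcongr; exact h q
    _ = Real.pi / 2 * calP := by rw [mul_div_assoc, mul_div_cancel_left₀ _ he.ne']

/-- kernel (real arithmetic): the assembly of the printed error term from the two squares. [folklore] -/
private theorem assembly {γ E S Δ c1 c2 a1 a2 X Cp E32 : ℝ} (hS : 0 ≤ S) (hc1 : 0 ≤ c1) (hc2 : 0 ≤ c2)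
    (h1 : γ / 2 * E - (c1 * (a1 * X) ^ 2 + c2 * (a2 * X) ^ 2) * S ≤ Δ) (hX : X ^ 2 ≤ Cp * E32) :
    γ / 2 * E - (c1 * a1 ^ 2 + c2 * a2 ^ 2) * Cp * E32 * S ≤ Δ := by
  have h0 : 0 ≤ (c1 * a1 ^ 2 + c2 * a2 ^ 2) * S := by positivity
  nlinarith [mul_le_mul_of_nonneg_left hX h0]

/-- **(7.3.2), SECOND PRINTED FORM, FOR THE ACTUAL BACKGROUND `u_k` OF (4.5.4) from the two sup-norm bounds**: on a torus with `2 ≤ d`,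
`1 ≤ k ≤ m + K`, `0 < e ≤ 1`, any `v`, if all oriented `η`-plaquette variables of `u_k` are within `eη²·K_R(π/2)𝓅` of `1` (p33's residual route)
and `|u_k(b) − v_b| ≤ e·K_T(π/2)𝓅` on every unit bond (the line sums, §1), then for THE inverse (4.6.2) `G` at `u_k` (printed `a_k`, physical
normalization) and every `ψ`:
`(γ/2)·Σ_b |v_bψ(b₊) − ψ(b₋)|² − ((4/3)d⁴((π/2)K_R)² + γd((π/2)K_T)²)(1+4𝓅₊)^{2𝓅₊}·e^{2−½}·Σ_x|ψ(x)|² ≤ ⟨ψ, Δ_k(u_k)ψ⟩`, `γ = min(a/(9(d+1)), 1/12)`,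
`𝓅 = (1 + ln e^{−1})^𝓅` (file A at `θ = eη²K_R(π/2)𝓅`, `κ = eK_T(π/2)𝓅`; `(L^k)²η² = 1`; `(e𝓅)² ≤ (1+4𝓅₊)^{2𝓅₊}e^{3/2}`).
[cite: BalabanImbrieJaffe1985, (7.3.2) p.326] -/
theorem ineq732_second_actual (hd2 : 2 ≤ P.d) {k : ℕ} (hk1 : 1 ≤ k) (hk : k ≤ P.m + P.K) {e : ℝ} (he : 0 < e) (he1 : e ≤ 1)
    (v : U1Field P k) (pexp : ℝ) {a : ℝ} (ha : 0 < a) {KR KT : ℝ}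
    {G : FineSp P 0 →ₗ[ℝ] FineSp P 0}
    (hG : ∀ φ, opT (Dlin (cPhys P k) (actualBgU1 hd2 k e v)) (QlinK (actualBgU1 hd2 k e v) k)
      (BIJ85Sect4Statements.aK a P.L k) (G φ) = φ)
    (hθ : ∀ (x : Balaban1983to89.Site P 0) (μ ν : Fin P.d), ‖plaqC (actualBgU1 hd2 k e v) x μ ν - 1‖ ≤
      e * (P.eta k) ^ 2 * (KR * (Real.pi / 2 * (1 + Real.log e⁻¹) ^ pexp)))
    (hκ : ∀ c : PBond P (0 + k), ‖toC (lineIter (actualBgU1 hd2 k e v) k c) - toC (vK k v c)‖ ≤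
      e * (KT * (Real.pi / 2 * (1 + Real.log e⁻¹) ^ pexp)))
    (ψ : CoarseSpK P 0 k) :
    min (a / (9 * (P.d + 1))) (1 / 12) / 2 * bondForm (vK k v) ψ
        - (4 / 3 * (P.d : ℝ) ^ 4 * (Real.pi / 2 * KR) ^ 2 + min (a / (9 * (P.d + 1))) (1 / 12) * P.d * (Real.pi / 2 * KT) ^ 2)
          * (1 + 4 * max pexp 0) ^ (2 * max pexp 0) * e ^ (2 - 1 / 2 : ℝ)
          * ∑ x : Balaban1983to89.Site P (0 + k), ‖ψ x‖ ^ 2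
      ≤ ⟪ψ, deltaOp (QlinK (actualBgU1 hd2 k e v) k) (BIJ85Sect4Statements.aK a P.L k) G ψ⟫ := by
  have hk0 : 0 + k ≤ P.m + P.K := by omega
  set calP : ℝ := (1 + Real.log e⁻¹) ^ pexp with hcalP
  have h1 := ineq732_second_general_phys' (j := 0) hk1 hk0 ha (actualBgU1 hd2 k e v) hθ hG (vK k v) hκ ψ
  have es : ((P.L : ℝ) ^ k) ^ 2 * (e * (P.eta k) ^ 2 * (KR * (Real.pi / 2 * calP))) = Real.pi / 2 * KR * (e * calP) := by
    have hη := pow_mul_eta_sq P k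
    calc ((P.L : ℝ) ^ k) ^ 2 * (e * (P.eta k) ^ 2 * (KR * (Real.pi / 2 * calP)))
        = (((P.L : ℝ) ^ k) ^ 2 * (P.eta k) ^ 2) * (Real.pi / 2 * KR * (e * calP)) := by ring
      _ = _ := by rw [hη, one_mul]
  have eκ : e * (KT * (Real.pi / 2 * calP)) = Real.pi / 2 * KT * (e * calP) := by ring
  rw [es, eκ] at h1
  have hS : 0 ≤ ∑ x : Balaban1983to89.Site P (0 + k), ‖ψ x‖ ^ 2 := sum_nonneg fun _ _ => by positivity
  have hc1 : (0 : ℝ) ≤ 4 / 3 * (P.d : ℝ) ^ 4 := by positivity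
  have hc2 : (0 : ℝ) ≤ min (a / (9 * ((P.d : ℝ) + 1))) (1 / 12) * P.d :=
    mul_nonneg (le_min (by positivity) (by norm_num)) (Nat.cast_nonneg _)
  have h2 := assembly hS hc1 hc2 h1 (sq_hyp731_le pexp he he1)
  simpa only [mul_assoc] using h2

/-- Index of the family of ACTUAL Sect. 7.3 data for the SECOND printed form: p33's `ResIdx d K_R` (torus of dimension `d ≥ 2`, scale
`1 ≤ k ≤ m + K`, coupling `0 < e_k ≤ 1`, ANY unit-lattice `U(1)` field `v`, the located residual property `|f_k| ≤ K_R·max|f|`) PLUS the located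
LINE-SUM property of the smoothing operator `T_k = 𝒟_k∂^*Q^{e*}_k` of (4.5.4) at constant `K_T`: `η·|Σ_{b′⊂b}(T_kg)_{b′}| ≤ K_T·C` for every unit
bond `b` whenever `|g(q)| ≤ C` for all `q` (Sect. 7.2: boundedness of the gauge function relating `𝒟_k∂^*` and `G_{k,Ax}∂^*`, (7.2.4)).
[cite: BalabanImbrieJaffe1985, (7.3.1) p.326] -/
structure SecIdx (d : ℕ) (KR KT : ℝ) extends ResIdx d KR where
  hT : ∀ (g : Balaban1983to89.Plaq P k → ℝ) (C : ℝ), (∀ q, |g q| ≤ C) →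
    ∀ c : PBond P (0 + k), P.eta k * |lineSumIter (TkF P hd2 ((P.eta k) ^ P.d) (P.eta k) k g) k c| ≤ KT * C

namespace SecIdx

variable {d : ℕ} {KR KT : ℝ}

/-- kernel: `K_T ≥ 0` (the property at `g = 0`, `C = 1`: the line sums are linear). [cite: BalabanImbrieJaffe1985, (4.5.4) p.313] -/
theorem KT_nonneg (i : SecIdx d KR KT) : 0 ≤ KT := by
  have h := i.hT (fun _ => 0) 1 (fun _ => by simp) ⟨default, ⟨0, by have := i.hd2; omega⟩⟩
  have h0 : (0 : ℝ) ≤ i.P.eta i.k * |lineSumIter (TkF i.P i.hd2 ((i.P.eta i.k) ^ i.P.d) (i.P.eta i.k) i.k (fun _ => (0 : ℝ))) i.k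
      ⟨default, ⟨0, by have := i.hd2; omega⟩⟩| := mul_nonneg (eta_pos _ _).le (abs_nonneg _)
  linarith

/-- kernel: (7.3.1) and the line-sum property give `|u_k(b) − v_b| ≤ e·K_T(π/2)𝓅(e)` on every unit bond.
[cite: BalabanImbrieJaffe1985, (7.3.1) p.326] -/
theorem kappa_of_hyp731 (i : SecIdx d KR KT) (pexp : ℝ)
    (h : ∀ p, ‖((plaq i.v p : Circle) : ℂ) - 1‖ ≤ i.e * (1 + Real.log i.e⁻¹) ^ pexp) (c : PBond i.P (0 + i.k)) :
    ‖toC (lineIter i.toResIdx.U i.k c) - toC (vK i.k i.v c)‖ ≤ i.e * (KT * (Real.pi / 2 * (1 + Real.log i.e⁻¹) ^ pexp)) := by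
  have hf := abs_plaqField_le_of_hyp i.he i.v h
  have hT := i.hT (plaqField i.e i.v) _ hf c
  have h1 := norm_toC_lineIter_actualBgU1_sub_le i.hd2 i.hk i.e i.v c
  rw [abs_of_pos i.he] at h1
  calc ‖toC (lineIter i.toResIdx.U i.k c) - toC (vK i.k i.v c)‖
      ≤ i.e * i.P.eta i.k * |lineSumIter (TkF i.P i.hd2 ((i.P.eta i.k) ^ i.P.d) (i.P.eta i.k) i.k (plaqField i.e i.v)) i.k c| := h1
    _ = i.e * (i.P.eta i.k * |lineSumIter (TkF i.P i.hd2 ((i.P.eta i.k) ^ i.P.d) (i.P.eta i.k) i.k (plaqField i.e i.v)) i.k c|) := by ring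
    _ ≤ i.e * (KT * (Real.pi / 2 * (1 + Real.log i.e⁻¹) ^ pexp)) := mul_le_mul_of_nonneg_left hT i.he.le

end SecIdx

/-- **THE ACTUAL Sect. 7.3 DATUM, SECOND PRINTED FORM** (model instance of r15's carrier): as p33's `resStabData` — plaquettes of `T₁^{(k)}` with
the PRINTED deviation `|v(∂p′) − 1|`, bonds/sites of the unit lattice (level `0 + k`), `ψ ∈ ℓ²(T₁^{(k)})`, `absSq ψ x = |ψ(x)|²`,
`deltaForm ψ = ⟨ψ, Δ_k(u_k)ψ⟩` at the ACTUAL `u_k` (printed `a_k`, physical normalization, THE inverse (4.6.2)) — EXCEPT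
**`covDiffSq ψ b = |v_bψ(b₊) − ψ(b₋)|²`**: *"The second form of the inequality substitutes v_b for u_k(b) in the covariant derivative of φ."*
[cite: BalabanImbrieJaffe1985, (7.3.2) p.326] -/
def secStabData {d : ℕ} {KR KT : ℝ} (a : ℝ) (ha : 0 < a) (i : SecIdx d KR KT) : BIJ85Sect7Statements.ScalarStabData where
  Plaq := Balaban1983to89.Plaq i.P i.k
  Bond := PBond i.P (0 + i.k)
  Site := Balaban1983to89.Site i.P (0 + i.k)
  Scalar := CoarseSpK i.P 0 i.k
  ek := i.e
  plaqDev := fun p => ‖((plaq i.v p : Circle) : ℂ) - 1‖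
  covDiffSq := fun ψ b => ‖toC (vK i.k i.v b) * ψ b.tgt - ψ b.src‖ ^ 2
  absSq := fun ψ x => ‖ψ x‖ ^ 2
  deltaForm := fun ψ => ⟪ψ, deltaOp (QlinK i.toResIdx.U i.k) (BIJ85Sect4Statements.aK a i.P.L i.k) (resG a ha i.toResIdx) ψ⟫

/-- **r15's typed (7.3.2) `Ineq732 γ α M` — SECOND PRINTED FORM — AT EVERY INDEX OF THE ACTUAL FAMILY under `Hyp731 𝓅`**, `γ = ½min(a/(9(d+1)), 1/12)`,
`α = ½`, `M = ((4/3)d⁴((π/2)K_R)² + min(a/(9(d+1)),1/12)·d·((π/2)K_T)²)(1+4𝓅₊)^{2𝓅₊}`. [cite: BalabanImbrieJaffe1985, (7.3.2) p.326] -/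
theorem ineq732_secStabData {d : ℕ} {KR KT : ℝ} (a : ℝ) (ha : 0 < a) (pexp : ℝ) (i : SecIdx d KR KT)
    (h : (secStabData a ha i).Hyp731 pexp) :
    (secStabData a ha i).Ineq732 (min (a / (9 * (d + 1))) (1 / 12) / 2) (1 / 2)
      ((4 / 3 * (d : ℝ) ^ 4 * (Real.pi / 2 * KR) ^ 2 + min (a / (9 * (d + 1))) (1 / 12) * d * (Real.pi / 2 * KT) ^ 2)
        * (1 + 4 * max pexp 0) ^ (2 * max pexp 0)) := by
  intro ψ
  change CoarseSpK i.P 0 i.k at ψ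
  have hd' : (i.P.d : ℝ) = d := by rw [i.hd]
  have hθ := theta_of_hyp731_res a ha i.toResIdx pexp h
  have hκ := i.kappa_of_hyp731 pexp h
  have hmain := ineq732_second_actual i.hd2 i.hk1 i.hk i.he i.he1 i.v pexp ha (resG_spec a ha i.toResIdx) hθ hκ ψ
  rw [hd'] at hmain
  exact hmain

/-- **r15's typed claim of Sect. 7.3 `ScalarStabData.Claim73 𝓅 fam` IN ITS SECOND PRINTED FORM — "(7.3.1) ⇒ (7.3.2) with v_b in the covariant
derivative of φ, for constants γ > 0, α > 0, M < ∞" — PROVED FOR THE FAMILY OF ACTUAL Sect. 7.3 DATA** `secStabData a` over `SecIdx d K_R K_T`: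
every torus of dimension `d ≥ 2`, every `1 ≤ k ≤ m + K`, every `0 < e_k ≤ 1`, EVERY unit-lattice `U(1)` field `v`, the background being (4.5.4)
COMPUTED FROM `v` with the operators of record and the hypothesis being the PRINTED (7.3.1) on `v`; the index carries the two located sup-norm
properties (residual curvature `K_R`, line sums `K_T` — Sect. 7.2; both proved at `k = 1`, §4).  Constants: `γ = ½min(a/(9(d+1)), 1/12)`, `α = ½`,
`M = ((4/3)d⁴((π/2)K_R)² + min(a/(9(d+1)),1/12)·d·((π/2)K_T)²)(1+4𝓅₊)^{2𝓅₊}`. [cite: BalabanImbrieJaffe1985, (7.3.1)–(7.3.2) p.326] -/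
theorem claim73_second {d : ℕ} (a : ℝ) (ha : 0 < a) (KR KT pexp : ℝ) :
    BIJ85Sect7Statements.ScalarStabData.Claim73 pexp (secStabData (d := d) (KR := KR) (KT := KT) a ha) :=
  ⟨min (a / (9 * (d + 1))) (1 / 12) / 2, 1 / 2,
    (4 / 3 * (d : ℝ) ^ 4 * (Real.pi / 2 * KR) ^ 2 + min (a / (9 * (d + 1))) (1 / 12) * d * (Real.pi / 2 * KT) ^ 2)
      * (1 + 4 * max pexp 0) ^ (2 * max pexp 0),
    by have : (0 : ℝ) < min (a / (9 * (d + 1))) (1 / 12) := lt_min (by positivity) (by norm_num); linarith, by norm_num,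
    fun i hi => ineq732_secStabData a ha pexp i hi⟩

/-! ## §3 The closed-field index (the k-uniform shape of the located inputs) -/

/-- Index for the second printed form over p33's CLOSED-field residual index `ClosedIdx d K_R 𝓅` (regime `e𝓅(e) ≤ ½`, under which `f^{(k)}` is
closed — `BIJ85Claim73Closed.dPlaq_plaqField_eq_zero`): the residual property AND the line-sum property of `T_k` are asked on CLOSED unit-lattice
plaquette fields only (the k-uniform shape: on non-closed sources both operators see the open ends of the flux tubes).
[cite: BalabanImbrieJaffe1985, (7.3.1) p.326] -/
structure SecClosedIdx (d : ℕ) (KR KT pexp : ℝ) extends ClosedIdx d KR pexp where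
  hT : ∀ (g : Balaban1983to89.Plaq P k → ℝ),
    (∀ (x : Balaban1983to89.Site P k) (μ ν lam : Fin P.d) (hμν : μ < ν) (hνl : ν < lam), dPlaq g x hμν hνl = 0) →
    ∀ (C : ℝ), (∀ q, |g q| ≤ C) →
      ∀ c : PBond P (0 + k), P.eta k * |lineSumIter (TkF P hd2 ((P.eta k) ^ P.d) (P.eta k) k g) k c| ≤ KT * C

namespace SecClosedIdx

variable {d : ℕ} {KR KT pexp : ℝ}

/-- kernel: `K_T ≥ 0` (at `g = 0`, which is closed). [cite: BalabanImbrieJaffe1985, (4.5.4) p.313] -/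
theorem KT_nonneg (i : SecClosedIdx d KR KT pexp) : 0 ≤ KT := by
  have h := i.hT (fun _ => 0) (fun _ _ _ _ _ _ => by simp [dPlaq]) 1 (fun _ => by simp) ⟨default, ⟨0, by have := i.hd2; omega⟩⟩
  have h0 : (0 : ℝ) ≤ i.P.eta i.k * |lineSumIter (TkF i.P i.hd2 ((i.P.eta i.k) ^ i.P.d) (i.P.eta i.k) i.k (fun _ => (0 : ℝ))) i.k
      ⟨default, ⟨0, by have := i.hd2; omega⟩⟩| := mul_nonneg (eta_pos _ _).le (abs_nonneg _)
  linarith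

/-- kernel: (7.3.1) in the regime `e𝓅 ≤ ½` and the closed-field line-sum property give `|u_k(b) − v_b| ≤ e·K_T(π/2)𝓅(e)`.
[cite: BalabanImbrieJaffe1985, (7.3.1) p.326] -/
theorem kappa_of_hyp731 (i : SecClosedIdx d KR KT pexp)
    (h : ∀ p, ‖((plaq i.v p : Circle) : ℂ) - 1‖ ≤ i.e * (1 + Real.log i.e⁻¹) ^ pexp) (c : PBond i.P (0 + i.k)) :
    ‖toC (lineIter i.toClosedIdx.U i.k c) - toC (vK i.k i.v c)‖ ≤ i.e * (KT * (Real.pi / 2 * (1 + Real.log i.e⁻¹) ^ pexp)) := by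
  have hf := abs_plaqField_le_of_hyp i.he i.v h
  have hclosed := dPlaq_plaqField_eq_zero i.he i.v i.hsmall h
  have hT := i.hT (plaqField i.e i.v) hclosed _ hf c
  have h1 := norm_toC_lineIter_actualBgU1_sub_le i.hd2 i.hk i.e i.v c
  rw [abs_of_pos i.he] at h1
  calc ‖toC (lineIter i.toClosedIdx.U i.k c) - toC (vK i.k i.v c)‖
      ≤ i.e * i.P.eta i.k * |lineSumIter (TkF i.P i.hd2 ((i.P.eta i.k) ^ i.P.d) (i.P.eta i.k) i.k (plaqField i.e i.v)) i.k c| := h1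
    _ = i.e * (i.P.eta i.k * |lineSumIter (TkF i.P i.hd2 ((i.P.eta i.k) ^ i.P.d) (i.P.eta i.k) i.k (plaqField i.e i.v)) i.k c|) := by ring
    _ ≤ i.e * (KT * (Real.pi / 2 * (1 + Real.log i.e⁻¹) ^ pexp)) := mul_le_mul_of_nonneg_left hT i.he.le

end SecClosedIdx

/-- The second-form datum over the closed-field index (as `secStabData`, with p33's `closedG` = THE inverse (4.6.2) at `u_k`).
[cite: BalabanImbrieJaffe1985, (7.3.2) p.326] -/
def secClosedStabData {d : ℕ} {KR KT pexp : ℝ} (a : ℝ) (ha : 0 < a) (i : SecClosedIdx d KR KT pexp) :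
    BIJ85Sect7Statements.ScalarStabData where
  Plaq := Balaban1983to89.Plaq i.P i.k
  Bond := PBond i.P (0 + i.k)
  Site := Balaban1983to89.Site i.P (0 + i.k)
  Scalar := CoarseSpK i.P 0 i.k
  ek := i.e
  plaqDev := fun p => ‖((plaq i.v p : Circle) : ℂ) - 1‖
  covDiffSq := fun ψ b => ‖toC (vK i.k i.v b) * ψ b.tgt - ψ b.src‖ ^ 2
  absSq := fun ψ x => ‖ψ x‖ ^ 2
  deltaForm := fun ψ => ⟪ψ, deltaOp (QlinK i.toClosedIdx.U i.k) (BIJ85Sect4Statements.aK a i.P.L i.k) (closedG a ha i.toClosedIdx) ψ⟫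

/-- `Ineq732`, second printed form, at every closed-field index under `Hyp731 𝓅` (same constants as `ineq732_secStabData`).
[cite: BalabanImbrieJaffe1985, (7.3.2) p.326] -/
theorem ineq732_secClosedStabData {d : ℕ} {KR KT pexp : ℝ} (a : ℝ) (ha : 0 < a) (i : SecClosedIdx d KR KT pexp)
    (h : (secClosedStabData a ha i).Hyp731 pexp) :
    (secClosedStabData a ha i).Ineq732 (min (a / (9 * (d + 1))) (1 / 12) / 2) (1 / 2)
      ((4 / 3 * (d : ℝ) ^ 4 * (Real.pi / 2 * KR) ^ 2 + min (a / (9 * (d + 1))) (1 / 12) * d * (Real.pi / 2 * KT) ^ 2)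
        * (1 + 4 * max pexp 0) ^ (2 * max pexp 0)) := by
  intro ψ
  change CoarseSpK i.P 0 i.k at ψ
  have hd' : (i.P.d : ℝ) = d := by rw [i.hd]
  have hθ := theta_of_hyp731_closed a ha i.toClosedIdx h
  have hκ := i.kappa_of_hyp731 h
  have hmain := ineq732_second_actual i.hd2 i.hk1 i.hk i.he i.he1 i.v pexp ha (closedG_spec a ha i.toClosedIdx) hθ hκ ψ
  rw [hd'] at hmain
  exact hmain

/-- **`Claim73 𝓅`, SECOND PRINTED FORM, over the closed-field index** `SecClosedIdx d K_R K_T 𝓅` — the k-uniform shape in which the two located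
inputs are expected (p33 g7's reading, GAPS G-C1-05 ADDENDUM 4a); same constants as `claim73_second`. [cite: BalabanImbrieJaffe1985, (7.3.1)–(7.3.2) p.326] -/
theorem claim73_second_closed {d : ℕ} (a : ℝ) (ha : 0 < a) (KR KT pexp : ℝ) :
    BIJ85Sect7Statements.ScalarStabData.Claim73 pexp (secClosedStabData (d := d) (KR := KR) (KT := KT) (pexp := pexp) a ha) :=
  ⟨min (a / (9 * (d + 1))) (1 / 12) / 2, 1 / 2,
    (4 / 3 * (d : ℝ) ^ 4 * (Real.pi / 2 * KR) ^ 2 + min (a / (9 * (d + 1))) (1 / 12) * d * (Real.pi / 2 * KT) ^ 2)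
      * (1 + 4 * max pexp 0) ^ (2 * max pexp 0),
    by have : (0 : ℝ) < min (a / (9 * (d + 1))) (1 / 12) := lt_min (by positivity) (by norm_num); linarith, by norm_num,
    fun i hi => ineq732_secClosedStabData a ha i hi⟩

/-! ## §4 `k = 1`: the line-sum property with NO located hypothesis -/

/-- kernel (row sums control the sup norm): for a linear map `T` of Euclidean spaces and `|x_j| ≤ C` for all `j`,
`|(Tx)_i| ≤ (Σ_j |(Te_j)_i|)·C`. [folklore] -/
private theorem abs_map_le_rowSum_mul {ι κ : Type*} [Fintype ι] [DecidableEq ι]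
    (T : EuclideanSpace ℝ ι →ₗ[ℝ] EuclideanSpace ℝ κ) (x : EuclideanSpace ℝ ι) {C : ℝ} (hx : ∀ j, |x j| ≤ C) (i : κ) :
    |T x i| ≤ (∑ j, |T (EuclideanSpace.single j 1) i|) * C := by
  have hxe : x = ∑ j, x j • EuclideanSpace.single j (1 : ℝ) := by
    ext i'
    simp [Finset.sum_apply, Pi.single_apply]
  have hTx : T x i = ∑ j, x j * T (EuclideanSpace.single j 1) i := by
    conv_lhs => rw [hxe, map_sum]
    simp [Finset.sum_apply, map_smul]
  rw [hTx, sum_mul]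
  refine (abs_sum_le_sum_abs _ _).trans (sum_le_sum fun j _ => ?_)
  rw [abs_mul, mul_comm]
  exact mul_le_mul_of_nonneg_left (hx j) (abs_nonneg _)

/-- **`|(T₁g)_b| ≤ 4dL·R₁·max|g|` on every torus**, `R₁ = M_Cd(2(1+d/δ_C))^d` the row-sum bound of `C^{(0)}_{(1,1)}` from
(7.2.3) at the finest scale (hypothesis `hC0`, the shape of p09's hypothesis-free `ineq723_CE` at `j = 0`): at `k = 1`,
`T₁ = 𝒟₁∂^*Q^{e*} = C^{(0)}∂^*Q^{e*}` (p33's `DkE_one`), with the sup-norms `√wL²` of `Q^{e*}`, `4d√wc` of `∂^*` and r18's rescaling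
`C^{(0)} = (wc²)⁻¹C^{(0)}_{(1,1)}` (`c = η⁻¹ = L`, `w = η^d`; the weight factors cancel). [cite: BalabanImbrieJaffe1985, (7.2.3) p.325] -/
theorem abs_TkF_one_le [DecidableEq (PBond P 0)] {MC δC : ℝ} (hδC : 0 < δC)
    (hC0 : ∀ b b' : PBond P 0, |⟪toEj P 0 (Pi.single b 1), CE P 1 1 0 (toEj P 0 (Pi.single b' 1))⟫| ≤
      MC * Real.exp (-(δC * (supDist b.src b'.src : ℝ))))
    (hd2 : 2 ≤ P.d) (g : Balaban1983to89.Plaq P 1 → ℝ) {C : ℝ} (hg : ∀ q, |g q| ≤ C) (b : PBond P 0) :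
    |TkF P hd2 ((P.eta 1) ^ P.d) (P.eta 1) 1 g b| ≤
      4 * P.d * (P.L : ℝ) * (MC * (P.d * (2 * (1 + P.d / δC)) ^ P.d)) * C := by
  set R1 : ℝ := MC * (P.d * (2 * (1 + P.d / δC)) ^ P.d) with hR1
  have hC : 0 ≤ C := (abs_nonneg _).trans (hg ⟨default, ⟨0, by omega⟩, ⟨1, by omega⟩, by simp [Fin.lt_def]⟩)
  set w : ℝ := (P.eta 1) ^ P.d with hw
  have hwpos : 0 < w := pow_pos (eta_pos P 1) _
  have hc : (P.eta 1)⁻¹ = (P.L : ℝ) := by rw [eta_inv, pow_one]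
  have hLpos : (0 : ℝ) < P.L := Nat.cast_pos.2 P.L_pos
  have hcne : (P.eta 1)⁻¹ ≠ 0 := by rw [hc]; exact hLpos.ne'
  have hrow : ∀ b : PBond P 0, ∑ b' : PBond P 0, |CE P 1 1 0 (EuclideanSpace.single b' 1) b| ≤ R1 := fun b =>
    rowSum_CE_zero_le hδC hC0 b
  -- |Q^{e*}F| ≤ √w L² C
  set F : UnitPlaqSpace P 1 := toU P 1 g with hF
  have h1 : ∀ q, |QesOp (P := P) hd2 w 1 F q| ≤ Real.sqrt w * (P.L : ℝ) ^ 2 * C := by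
    intro q
    have := abs_QesOp_le hd2 w 1 F (C := C) (fun q' => hg q') q
    simpa using this
  -- |∂^*Q^{e*}F| ≤ 4d√wc · √wL²C
  set G : BondSpace P := LinearMap.adjoint (curlOp (P := P) w (P.eta 1)⁻¹) (QesOp (P := P) hd2 w 1 F) with hG
  have h2 : ∀ b, |G b| ≤ 4 * P.d * (Real.sqrt w * |(P.eta 1)⁻¹|) * (Real.sqrt w * (P.L : ℝ) ^ 2 * C) := fun b =>
    abs_adjoint_curlOp_le _ _ _ (by positivity) h1 b
  -- 𝒟₁G = (wc²)⁻¹ C^{(0)}_{(1,1)} G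
  have hD : DkE P w (P.eta 1)⁻¹ 1 G = (w * (P.eta 1)⁻¹ ^ 2)⁻¹ • CE P 1 1 0 G := by
    rw [DkE_one P hcne hwpos, cE_eq_smul_cE_one hwpos hcne, LinearMap.smul_apply]
  have hwc : 0 < w * (P.eta 1)⁻¹ ^ 2 := by positivity
  have h3 : |DkE P w (P.eta 1)⁻¹ 1 G b| ≤
      (w * (P.eta 1)⁻¹ ^ 2)⁻¹ * (R1 * (4 * P.d * (Real.sqrt w * |(P.eta 1)⁻¹|) * (Real.sqrt w * (P.L : ℝ) ^ 2 * C))) := by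
    rw [hD, PiLp.smul_apply, smul_eq_mul, abs_mul, abs_of_pos (inv_pos.2 hwc)]
    refine mul_le_mul_of_nonneg_left ?_ (inv_pos.2 hwc).le
    refine (abs_map_le_rowSum_mul (CE P 1 1 0) G h2 b).trans ?_
    exact mul_le_mul_of_nonneg_right (hrow b) (by positivity)
  rw [TkF_apply]
  refine h3.trans (le_of_eq ?_)
  rw [hc, abs_of_pos hLpos]
  have hsq : w = Real.sqrt w ^ 2 := (Real.sq_sqrt hwpos.le).symm
  have hs : 0 < Real.sqrt w := Real.sqrt_pos.2 hwpos
  clear_value w F G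
  generalize Real.sqrt w = s at hs hsq ⊢
  subst hsq
  field_simp

/-- **THE LINE-SUM PROPERTY AT `k = 1` ON EVERY TORUS** (the located input `hT`, DISCHARGED for the first step): there is `K_T(d, L) ≥ 0` such that
on every torus with `P.d = d ≥ 2`, `P.L = L`, `1 ≤ m + K`, for every unit-lattice plaquette field `g` with `|g| ≤ C` and every unit bond `b`:
`η·|Σ_{b′⊂b}(T₁g)_{b′}| ≤ K_T·C` — the line sum has `L` terms each `≤ 4dLR₁C` and `η = L^{−1}`: `K_T(1) = 4dL·M_Cd(2(1+d/δ_C))^d`, from p09's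
hypothesis-free (7.2.3) `ineq723_CE`. [cite: BalabanImbrieJaffe1985, (7.2.3) p.325] -/
theorem lineSumBound_one (d L : ℕ) (hd : 2 ≤ d) :
    ∃ K : ℝ, 0 ≤ K ∧ ∀ (P : Params), P.d = d → P.L = L → 1 ≤ P.m + P.K → ∀ (hd2 : 2 ≤ P.d)
      (g : Balaban1983to89.Plaq P 1 → ℝ) (C : ℝ), (∀ q, |g q| ≤ C) →
        ∀ c : PBond P (0 + 1), P.eta 1 * |lineSumIter (TkF P hd2 ((P.eta 1) ^ P.d) (P.eta 1) 1 g) 1 c| ≤ K * C := by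
  classical
  obtain ⟨MC, δC, hMC, hδC, H⟩ := ineq723_CE d L hd
  refine ⟨4 * d * (L : ℝ) * (MC * (d * (2 * (1 + d / δC)) ^ d)), by positivity, ?_⟩
  intro P hP hPL hmK hd2 g C hg c
  have hC0 : ∀ b b' : PBond P 0, |⟪toEj P 0 (Pi.single b 1), CE P 1 1 0 (toEj P 0 (Pi.single b' 1))⟫| ≤
      MC * Real.exp (-(δC * (supDist b.src b'.src : ℝ))) := by
    intro b b'
    have h := H P hP hPL 0 inferInstance (by omega) b b'
    simpa [Params.eta] using h
  have hB : ∀ b, |TkF P hd2 ((P.eta 1) ^ P.d) (P.eta 1) 1 g b| ≤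
      4 * P.d * (P.L : ℝ) * (MC * (P.d * (2 * (1 + P.d / δC)) ^ P.d)) * C := fun b =>
    abs_TkF_one_le hδC hC0 hd2 g hg b
  have hsum := abs_lineSumU_le hB c
  have hη := eta_mul_L_pow P 1
  rw [pow_one] at hη
  show P.eta 1 * |lineSumU (TkF P hd2 ((P.eta 1) ^ P.d) (P.eta 1) 1 g) c| ≤ _
  calc P.eta 1 * |lineSumU (TkF P hd2 ((P.eta 1) ^ P.d) (P.eta 1) 1 g) c|
      ≤ P.eta 1 * (P.L * (4 * P.d * (P.L : ℝ) * (MC * (P.d * (2 * (1 + P.d / δC)) ^ P.d)) * C)) :=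
        mul_le_mul_of_nonneg_left hsum (eta_pos P 1).le
    _ = 4 * P.d * (P.L : ℝ) * (MC * (P.d * (2 * (1 + P.d / δC)) ^ P.d)) * C := by
        rw [← mul_assoc, hη, one_mul]
    _ = 4 * d * (L : ℝ) * (MC * (d * (2 * (1 + d / δC)) ^ d)) * C := by rw [hP, hPL]

/-- the line-sum constant `K_T(d, L)` at `k = 1` of `lineSumBound_one`. [cite: BalabanImbrieJaffe1985, (7.2.3) p.325] -/
def KT1 (d L : ℕ) (hd : 2 ≤ d) : ℝ := Classical.choose (lineSumBound_one d L hd)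

/-- kernel: the defining property of `K_T(d, L)`. [cite: BalabanImbrieJaffe1985, (7.2.3) p.325] -/
theorem KT1_spec (d L : ℕ) (hd : 2 ≤ d) :
    0 ≤ KT1 d L hd ∧ ∀ (P : Params), P.d = d → P.L = L → 1 ≤ P.m + P.K → ∀ (hd2 : 2 ≤ P.d)
      (g : Balaban1983to89.Plaq P 1 → ℝ) (C : ℝ), (∀ q, |g q| ≤ C) →
        ∀ c : PBond P (0 + 1), P.eta 1 * |lineSumIter (TkF P hd2 ((P.eta 1) ^ P.d) (P.eta 1) 1 g) 1 c| ≤ KT1 d L hd * C :=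
  Classical.choose_spec (lineSumBound_one d L hd)

/-- **every first-step index (p33's `OneIdx d L`: any torus with `(d, L)` and a block level, `0 < e ≤ 1`, ANY `v`) is an index of the second-form
family at the constants `K₁(d, L)` (p33's `resBound_one`) and `K_T(d, L)` (`lineSumBound_one`)** — both located inputs DISCHARGED at `k = 1`.
[cite: BalabanImbrieJaffe1985, (7.3.1) p.326] -/
def secIdxOfOne {d L : ℕ} (hd : 2 ≤ d) (i : OneIdx d L) : SecIdx d (K1 d L hd) (KT1 d L hd) where
  toResIdx := i.toResIdx hd
  hT := fun g C hg c => (KT1_spec d L hd).2 i.P i.hd i.hL i.hmK i.hd2 g C hg c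

/-- **THE FIRST RENORMALIZATION STEP, SECOND PRINTED FORM, HYPOTHESIS-FREE**: r15's `Claim73 𝓅` for the second-form datum (`v_b` in the covariant
derivative of `ψ`) of the ACTUAL first-step family — every torus of dimension `d ≥ 2` and block size `L`, every `0 < e ≤ 1`, EVERY unit-lattice
`U(1)` field `v`, `u₁ = Q^{s*}v·exp[−ieη(𝒟₁∂^*Q^{e*}f^{(1)})]` computed from `v` with the operators of record, hypothesis = the printed (7.3.1) on `v`.
Constants: `γ = ½min(a/(9(d+1)), 1/12)`, `α = ½`, `M = ((4/3)d⁴((π/2)K₁)² + min(a/(9(d+1)),1/12)·d·((π/2)K_T(d,L))²)(1+4𝓅₊)^{2𝓅₊}`.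
[cite: BalabanImbrieJaffe1985, (7.3.1)–(7.3.2) p.326] -/
theorem claim73_second_one {d L : ℕ} (hd : 2 ≤ d) (a : ℝ) (ha : 0 < a) (pexp : ℝ) :
    BIJ85Sect7Statements.ScalarStabData.Claim73 pexp (fun i : OneIdx d L => secStabData a ha (secIdxOfOne hd i)) := by
  obtain ⟨γ, α, M, hγ, hα, H⟩ := claim73_second (d := d) a ha (K1 d L hd) (KT1 d L hd) pexp
  exact ⟨γ, α, M, hγ, hα, fun i hi => H (secIdxOfOne hd i) hi⟩

/-- kernel: the hypothesis of the first-step second-form family IS the printed (7.3.1) on `v`. [cite: BalabanImbrieJaffe1985, (7.3.1) p.326] -/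
theorem hyp731_second_one_iff {d L : ℕ} (hd : 2 ≤ d) (a : ℝ) (ha : 0 < a) (pexp : ℝ) (i : OneIdx d L) :
    (secStabData a ha (secIdxOfOne hd i)).Hyp731 pexp ↔
      ∀ p' : Balaban1983to89.Plaq i.P 1, ‖((plaq i.v p' : Circle) : ℂ) - 1‖ ≤ i.e * (1 + Real.log i.e⁻¹) ^ pexp :=
  Iff.rfl

/-- kernel: the conclusion of the first-step second-form family IS the second printed form — the bond term is `Σ_b |v_bψ(b₊) − ψ(b₋)|²` with the
unit-lattice field `v` itself. [cite: BalabanImbrieJaffe1985, (7.3.2) p.326] -/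
theorem covDiffSq_second_one {d L : ℕ} (hd : 2 ≤ d) (a : ℝ) (ha : 0 < a) (i : OneIdx d L) (ψ : CoarseSpK i.P 0 1)
    (b : PBond i.P (0 + 1)) :
    (secStabData a ha (secIdxOfOne hd i)).covDiffSq ψ b = ‖toC (vK 1 i.v b) * ψ b.tgt - ψ b.src‖ ^ 2 := rfl

/-! ## §5 On each torus and scale the line-sum property holds with some constant -/

/-- kernel: the line sums are additive. [cite: BalabanImbrieJaffe1985, (5.1.2) p.313] -/
theorem lineSumU_add {j : ℕ} (θ θ' : PBond P j → ℝ) : lineSumU (fun b => θ b + θ' b) = fun c => lineSumU θ c + lineSumU θ' c := by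
  funext c
  simp [lineSumU, sum_add_distrib]

/-- kernel: the iterated line sums are additive. [cite: BalabanImbrieJaffe1985, (5.1.2) p.313] -/
theorem lineSumIter_add {j : ℕ} (θ θ' : PBond P j → ℝ) :
    ∀ k : ℕ, lineSumIter (fun b => θ b + θ' b) k = fun c => lineSumIter θ k c + lineSumIter θ' k c
  | 0 => rfl
  | k + 1 => by rw [lineSumIter_succ, lineSumIter_add θ θ' k, lineSumU_add]; rfl

/-- the line sums as a linear map (plumbing for the finite-dimensional bound). [cite: BalabanImbrieJaffe1985, (5.1.2) p.313] -/
def lineSumLin (j k : ℕ) : (PBond P j → ℝ) →ₗ[ℝ] (PBond P (j + k) → ℝ) where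
  toFun θ := lineSumIter θ k
  map_add' θ θ' := lineSumIter_add θ θ' k
  map_smul' a θ := by
    show lineSumIter (fun b => a * θ b) k = _
    rw [lineSumIter_smul]
    rfl

/-- kernel: unfolding `lineSumLin`. [cite: BalabanImbrieJaffe1985, (5.1.2) p.313] -/
theorem lineSumLin_apply (j k : ℕ) (θ : PBond P j → ℝ) : lineSumLin (P := P) j k θ = lineSumIter θ k := rfl

/-- **On each torus and scale the line-sum property holds with some constant** (finite dimension: the map `g ↦ η·Σ_{b′⊂b}(T_kg)_{b′}` is linear),
so every `(P, k, e_k, v)` indexes `SecIdx d K_R K` for suitable `K = K(P, k)`; the located content of the field `hT` is that ONE `K_T` serves the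
whole family (uniformity in `k`, in the volume and in `g`) — Sect. 7.2. [cite: BalabanImbrieJaffe1985, (4.5.4) p.313] -/
theorem exists_lineSumBound (hd2 : 2 ≤ P.d) (k : ℕ) :
    ∃ K : ℝ, ∀ (g : Balaban1983to89.Plaq P k → ℝ) (C : ℝ), (∀ q, |g q| ≤ C) →
      ∀ c : PBond P (0 + k), P.eta k * |lineSumIter (TkF P hd2 ((P.eta k) ^ P.d) (P.eta k) k g) k c| ≤ K * C := by
  classical
  set Lk : (Balaban1983to89.Plaq P k → ℝ) →ₗ[ℝ] (PBond P (0 + k) → ℝ) :=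
    lineSumLin 0 k ∘ₗ TkF P hd2 ((P.eta k) ^ P.d) (P.eta k) k with hLk
  have hLap : ∀ g c, lineSumIter (TkF P hd2 ((P.eta k) ^ P.d) (P.eta k) k g) k c = Lk g c := fun g c => rfl
  refine ⟨P.eta k * ∑ q : Balaban1983to89.Plaq P k, ∑ c' : PBond P (0 + k), |Lk (Pi.single q 1) c'|, ?_⟩
  intro g C hg c
  have hC : 0 ≤ C := (abs_nonneg _).trans (hg ⟨default, ⟨0, by omega⟩, ⟨1, by omega⟩, by simp [Fin.lt_def]⟩)
  have hg' : g = ∑ q, g q • (Pi.single q (1 : ℝ) : Balaban1983to89.Plaq P k → ℝ) := by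
    ext q'
    simp [Finset.sum_apply, Pi.single_apply]
  rw [hLap, hg', map_sum]
  simp only [map_smul]
  rw [show (∑ q, g q • Lk (Pi.single q 1)) c = ∑ q, g q * Lk (Pi.single q 1) c by simp [Finset.sum_apply], mul_assoc]
  refine mul_le_mul_of_nonneg_left ?_ (eta_pos P k).le
  calc |∑ q, g q * Lk (Pi.single q 1) c| ≤ ∑ q, |g q * Lk (Pi.single q 1) c| := abs_sum_le_sum_abs _ _
    _ = ∑ q, |g q| * |Lk (Pi.single q 1) c| := by simp_rw [abs_mul]
    _ ≤ ∑ q, C * ∑ c' : PBond P (0 + k), |Lk (Pi.single q 1) c'| := by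
        refine sum_le_sum fun q _ => ?_
        exact mul_le_mul (hg q)
          (single_le_sum (f := fun c' : PBond P (0 + k) => |Lk (Pi.single q 1) c'|) (fun _ _ => abs_nonneg _) (mem_univ c))
          (abs_nonneg _) hC
    _ = (∑ q, ∑ c' : PBond P (0 + k), |Lk (Pi.single q 1) c'|) * C := by rw [← mul_sum, mul_comm]

end

end Literature.MathematicalPhysics.QuantumFieldTheory.BalabanImbrieJaffe1984to88.BIJ85Claim73SecondForm
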